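import Summits.AnomalousDissipation.AnomalousDissipation.Theorems.TwoAndHalfDTwohalfdNegReductionOffZero
import Summits.AnomalousDissipation.AnomalousDissipation.Theorems.TwoAndHalfDTwohalfdNegPerForceCertificate
import Summits.AnomalousDissipation.AnomalousDissipation.Theorems.TwoAndHalfDTwohalfdNegPlanarNoAnomaly
import Literature.Analysis.FluidPDE.TwoHalfSection
import Literature.Analysis.FluidPDE.LerayHopfGalileanTorusMeans
import Literature.Analysis.FluidPDE.LongTimeAverageNonneg

/-!
# O1 `stub_planarSubLogNoGo` — the PLANAR sub-log-strain no-go in X's own language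
# (line `Sketch`, crux stmt-AnomalousDissipation-0206)

Registered tool stub (section O, the witness window) of the line `Sketch` (duhamel-release) for the crux
`Summit.AnomalousDissipation.AnomalousDissipation.Theses.TwoAndHalfD.TwohalfdThesis` (= X,
stmt-AnomalousDissipation-0206): the zeroth law inside the `x₃`-invariant (2½-D) class — one steady smooth
solenoidal mean-zero `x₃`-invariant force `f` on `T³`, `ν_j → 0`, `x₃`-invariant global Leray–Hopf
solutions `u_j` with `ν`-uniformly bounded `limsup`-mean energy and `limsup`-mean dissipation `≥ ε > 0`.

For every such X-witness `(f, ν, u₀, u)` the `limsup`-mean STRAIN of the PLANAR SECTION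
`v_j(t) = π_E ∘ u_j(t) ∘ ι` (`ι = Torus.planarSect`, `π_E = Torus.planarProjE`) is NOT sub-logarithmic:
`¬ (⟨‖∇v_j‖₂⟩ / log(1/ν_j) → 0)`.  The tree had this only for the FULL gradient `‖∇u_j‖₂`
(`TwohalfdNeg.SubLogFamily.not_subLogStrain_of_dissipationFloor`), a quantity dominated by the scalar
gradient; the planar form is the informative one (Alexakis–Doering: `ν_j⟨‖∇v_j‖₂²⟩ → 0`).

Proof (plumbing over landed 0211 files).  `TwohalfdNeg.ReductionOffZero.stub_reductionOffZero` splits the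
family into its sections `g, h, v_j, θ_j` with `u_j(t) = twoHalf (v_j t) (θ_j t)` for `t ≠ 0`, `v_j` a global
Leray–Hopf solution of the planar system forced by `g` with bounded mean energy, `θ_j` a global weak sourced
scalar over `v_j` with bounded mean variance, and the sub-split
`meanDissipation ν_j u_j ≤ meanDissipation ν_j v_j + ⟨ν_j‖∇θ_j‖²⟩`.  Off `t = 0` the planar section of `u_j`
IS `v_j` (`Torus.planarProjE_twoHalf_planarSect`), and long-time means only see positive times
(`longTimeAvgSup_congr_of_eqOn_Ioi`), so the hypothesised sub-log strain of the section is sub-log strain of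
`v_j`.  Then the planar dissipation tends to `0` (`TwohalfdNeg.PlanarNoAnomaly.stub_planarNoAnomaly`,
Alexakis–Doering) and so does the scalar dissipation (the per-family engine
`TwohalfdNeg.PerForce.scalarNoAnomaly_of_subLogStrain_family`); squeezing the sub-split between `0`
(`meanDissipation_nonneg`) and the vanishing sum contradicts the floor `ε ≤ meanDissipation ν_j u_j`.
Model: `TwohalfdNeg.SubLogFamily.not_subLogStrain_of_dissipationFloor`.  Supports stmt-AnomalousDissipation-0206.

## Mathlib / Literature search

`lean search 'planarProjE_twoHalf_planarSect'` (`Literature/Analysis/FluidPDE/TwoHalfSection.lean`),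
`'longTimeAvgSup_congr_of_eqOn_Ioi'` (`Literature/Analysis/FluidPDE/LerayHopfGalileanTorusMeans.lean`),
`'meanDissipation_nonneg'` (`Literature/Analysis/FluidPDE/LongTimeAverageNonneg.lean`),
`'stub_planarSubLogNoGo'` (only the skeleton); `lean find` (prior stockroom): nothing to adapt.
-/

noncomputable section

-- the summit path AnomalousDissipation/AnomalousDissipation duplicates a namespace component
set_option linter.dupNamespace false

namespace Summit.AnomalousDissipation.AnomalousDissipation.Theorems.TwohalfdThesis

open MeasureTheory Set Filter Topology
open scoped ENNReal NNReal
open Literature.Analysis.FunctionSpaces Literature.Analysis.FluidPDE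
open Summit.AnomalousDissipation.AnomalousDissipation.Theorems.TwohalfdNeg

/-- **Off `t = 0` the planar section of a `2½`-dimensional family is its planar part, in the mean.**  If
`u t = twoHalf (v t) (θ t)` for every `t ≠ 0`, then the `limsup`-mean strain of the planar section
`t ↦ π_E ∘ u t ∘ ι` equals that of `v` (`planarProjE_twoHalf_planarSect` slice-wise for `t > 0`,
`longTimeAvgSup_congr_of_eqOn_Ioi`). [folklore] -/
theorem longTimeAvgSup_sqrt_eGradNormSq_planarSection_eq
    {u : ℝ → UnitAddTorus (Fin 3) → EuclideanSpace ℝ (Fin 3)}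
    {v : ℝ → UnitAddTorus (Fin 2) → EuclideanSpace ℝ (Fin 2)} {θ : ℝ → UnitAddTorus (Fin 2) → ℝ}
    (hsec : ∀ t : ℝ, t ≠ 0 → u t = Torus.twoHalf (v t) (θ t)) :
    longTimeAvgSup (fun t => Real.sqrt (Torus.eGradNormSq
        (fun y : UnitAddTorus (Fin 2) => Torus.planarProjE (u t (Torus.planarSect y)))).toReal) =
      longTimeAvgSup (fun t => Real.sqrt (Torus.eGradNormSq (v t)).toReal) := by
  refine longTimeAvgSup_congr_of_eqOn_Ioi fun t ht => ?_
  have hslice : (fun y : UnitAddTorus (Fin 2) => Torus.planarProjE (u t (Torus.planarSect y))) = v t := by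
    funext y
    rw [hsec t ht.ne']
    exact Torus.planarProjE_twoHalf_planarSect (v t) (θ t) y
  rw [hslice]

/-- **O1 `stub_planarSubLogNoGo` — the PLANAR sub-log-strain no-go in X's own language.**  For every
X-witness `(f, ν, u₀, u)` (all hypotheses of `TwohalfdThesis` verbatim) the `limsup`-mean strain of the
planar section `v_j(t) = π_E ∘ u_j(t) ∘ ι` is not sub-logarithmic: `¬ (⟨‖∇v_j‖₂⟩ / log(1/ν_j) → 0)`.
Reduction `ReductionOffZero.stub_reductionOffZero`, identification of the section's strain with `v_j`'s
(`longTimeAvgSup_sqrt_eGradNormSq_planarSection_eq`), planar dissipation `→ 0`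
(`PlanarNoAnomaly.stub_planarNoAnomaly`), scalar dissipation `→ 0`
(`PerForce.scalarNoAnomaly_of_subLogStrain_family`), squeeze against the floor `ε`. [folklore] -/
theorem stub_planarSubLogNoGo :
    ∀ f : UnitAddTorus (Fin 3) → EuclideanSpace ℝ (Fin 3),
      (∀ (s : UnitAddCircle) (x : UnitAddTorus (Fin 3)), f (x + Pi.single (2 : Fin 3) s) = f x) →
      Torus.IsSmooth f → Torus.IsDivFree f → Torus.HasZeroMean f →
      ∀ (ν : ℕ → ℝ) (u₀ : ℕ → UnitAddTorus (Fin 3) → EuclideanSpace ℝ (Fin 3))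
        (u : ℕ → ℝ → UnitAddTorus (Fin 3) → EuclideanSpace ℝ (Fin 3)),
        (∀ j, 0 < ν j) → Tendsto ν atTop (𝓝 0) →
        (∀ j, Torus.IsGlobalLerayHopf (ν j) (fun _ => f) (u₀ j) (u j)) →
        (∀ j (t : ℝ) (s : UnitAddCircle) (x : UnitAddTorus (Fin 3)),
          u j t (x + Pi.single (2 : Fin 3) s) = u j t x) →
        (∃ E : ℝ, ∀ j, meanEnergy (u j) ≤ E) →
        (∃ ε : ℝ, 0 < ε ∧ ∀ j, ε ≤ meanDissipation (ν j) (u j)) →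
        ¬ Tendsto (fun j => longTimeAvgSup (fun t => Real.sqrt (Torus.eGradNormSq
            (fun y : UnitAddTorus (Fin 2) => Torus.planarProjE (u j t (Torus.planarSect y)))).toReal) /
          Real.log (ν j)⁻¹) atTop (𝓝 0) := by
  intro f hfinv hfs hfd hfz ν u₀ u hν hν0 hLH huinv hE hfloor hsub
  obtain ⟨ε, hε, hεj⟩ := hfloor
  obtain ⟨g, h, v₀, v, θ₀, θ, hgs, hgd, hgz, hhs, hhz, -, hsec, hvLH, hθ₀, hθw, hEv, hEθ, hsplit⟩ :=
    ReductionOffZero.stub_reductionOffZero f hfinv hfs hfd hfz ν u₀ u hν hLH huinv hE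
  -- the section's strain is `v_j`'s strain, hence sub-logarithmic
  have hsub' : Tendsto (fun j => longTimeAvgSup (fun t => Real.sqrt (Torus.eGradNormSq (v j t)).toReal) /
      Real.log (ν j)⁻¹) atTop (𝓝 0) := by
    refine hsub.congr fun j => ?_
    rw [longTimeAvgSup_sqrt_eGradNormSq_planarSection_eq (hsec j)]
  -- planar dissipation `→ 0` (Alexakis–Doering) and scalar dissipation `→ 0` (per-family engine)
  have hplanar : Tendsto (fun j => meanDissipation (ν j) (v j)) atTop (𝓝 0) :=
    PlanarNoAnomaly.stub_planarNoAnomaly g hgs hgd hgz ν v₀ v hν hν0 hvLH hEv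
  have hscalar : Tendsto (fun j => longTimeAvgSup
      (fun t => ν j * (Torus.eScalarGradNormSq (θ j t)).toReal)) atTop (𝓝 0) :=
    PerForce.scalarNoAnomaly_of_subLogStrain_family g h hgs hgd hgz hhs hhz ν v₀ v θ₀ θ hν hν0 hvLH hEv
      hsub' hθ₀ hθw hEθ
  have hsum : Tendsto (fun j => meanDissipation (ν j) (v j) +
      longTimeAvgSup (fun t => ν j * (Torus.eScalarGradNormSq (θ j t)).toReal)) atTop (𝓝 0) := by
    simpa using hplanar.add hscalar
  -- squeeze the sub-split: the total mean dissipation tends to `0`, contradicting the floor `ε`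
  have ht : Tendsto (fun j => meanDissipation (ν j) (u j)) atTop (𝓝 0) :=
    squeeze_zero (fun j => meanDissipation_nonneg (hν j).le (u j)) hsplit hsum
  obtain ⟨j, hj⟩ := (ht.eventually (gt_mem_nhds hε)).exists
  exact (not_lt.2 (hεj j)) hj

end Summit.AnomalousDissipation.AnomalousDissipation.Theorems.TwohalfdThesis

end
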